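import Literature.IUT.HodgeTheaters.FrobenioidBridgeEx54ivInfKappaArithCompatNV
import Literature.IUT.HodgeTheaters.InitialThetaDataAbsoluteGalois
import HarnessLib

/-!
# [IUTchI] Definition 5.2 (v), Example 5.4 (iv): the local `∞κ`-coric kit of a field `L'` TRANSPORTED ALONG A RING ISOMORPHISM
# `ψ : Φ ≃+* L'(t)` — generic transport of structure for the LOCAL HALF of the reconstruction presentation (GAP B = G-L5t9g8-1,
# LATER TRANCHE item GB-20 «LOCAL RECON TWIN», generic §; abc-iut-L5-lead RULINGS #352 row GB-20, #356; `plan/GAP-ITEMS.tsv` v1.0)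

S. Mochizuki, *Inter-universal Teichmüller theory I*, kurims manuscript (May 2020), Definition 5.2 (v) p. 135 («pseudo-monoids of
κ-, `∞κ`-, and `∞κ×`-coric rational functions associated to `C_v` … equipped with their natural `π₁^{rat}(‡𝒟_v)`-actions»), Example
5.4 (iv) p. 149 ll. 3–31 (restriction of Kummer classes `†𝕄^⊛_{∞κ} → ‡𝕄_{∞κv} ⊆ ‡𝕄_{∞κ×v}`, equivariant along `π₁^{rat}(‡𝒟_v) →
π₁^{rat}(†𝒟^⊛)`). ([IUTchI] Def 5.2 (v) p.135) [claim: Mochizuki2012, status: disputed] (D-0012 claim key, series DISPUTED — THIS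
file is elementary transport of structure along a GIVEN ring isomorphism at OUR typed objects; nothing of the series is asserted; no
side is taken on [IUTchIII] Cor. 3.12, D-0045).

## What is built (the local twin of GB-18 ★ p676074 §0, stated ONCE for an arbitrary `ψ`; GB-01/02/03/10/12 ★ files untouched, imported)

For a field `Φ` (at the datum: the function field `K_{A,v} = (A.obj Π_{C_v}).functionField` OUTPUT by a [AbsTopIII] Cor-1.10 algorithm)
and a ring isomorphism `ψ : Φ ≃+* L'(t)` onto the rational function field of a characteristic-`0` field `L'` (at the datum: THE local
comparison isomorphism `phiC v` onto `K_v(t)`, carried as data by GB-20's `ReconLocObjects`):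
* `transportClosureEquiv ψ = e_ψ : Λ_Φ := AlgebraicClosure Φ ≃+* Λ_{L'}` extending `ψ` (`IsAlgClosure.equivOfEquiv`), `L'(t)`-linear
  for the structure `transportAlgebra ψ` through `ψ⁻¹`; `transportGal ψ = G_ψ^{rat} := Gal(Λ_Φ/L'(t))`; `transportGalEquiv ψ = ρ_ψ :
  G_ψ^{rat} ≃ₜ* G_{L'}^{rat}` (conjugation by `e_ψ`, bicontinuous); `e_ψ (σ • x) = ρ_ψ(σ) • e_ψ x`;
* `transportKit ψ S U` — GB-02's t4-shape kit `S.infKappaCoricKit U` (★ p667849) CARRIED ALONG `e_ψ` (`∞κ×`-carrier the `e_ψ`-preimage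
  of `𝕄_{∞κ×v}`, by GB-01's `CoricPair.ofStableSet` BY NAME; `∞κ`-part likewise), `transportLayer` its bundled form, the carrier
  identification `transportCarrierEquiv` (`e_ψ⁻¹`) with its laws (`_mem_infk_iff`, `_smul`, `mem_dom_iff_`);
* the two operations of Ex 5.4 (iv) for the transported layer over a base map `φ : L → L'`: `transportRatHom := ratHom_φ ∘ ρ_ψ`
  (GB-03 ★), `transportResKummer := e_ψ⁻¹ ∘ ι_φ` (GB-10 §1's `resKummerOfField`), with clauses (a)(b)(c) PROVED
  (`transportResKummer_mem_infk / _smul / _op`) and the non-vacuity `exists_mem_transportKit_infk` (`1 ∈ 𝕄_{∞κv}`).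

HONEST LABELS.  TRANSPORTED, NOT RECONSTRUCTED: every object is GB-02's MODEL object at `L'` read through `e_ψ`; the laws hold for ANY
`ψ`.  Definitions + theorems only: no `instance` (algebra structures are `def`s bound with `letI`), no notation, no axiom, no `sorry`;
typed ≠ inhabited ≠ proved-in-print ≠ tokened; count-neutral; nothing here asserts abc proved or refuted.
-/

noncomputable section

namespace Literature.IUT.HodgeTheaters

open CriticalLocus RatBaseChange

universe u v w

namespace CriticalLocus

section IsoTransport

variable {Φ : Type u} [Field Φ] {L' : Type v} [Field L'] (ψ : Φ ≃+* RatFunc L')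

/-- The `L'(t)`-algebra structure on `Φ` THROUGH `ψ⁻¹` (a DEFINITION; `letI`). ([IUTchI] Def 5.2 (v) p.135) [claim: Mochizuki2012, status: disputed] -/
@[reducible] def transportAlgebra : Algebra (RatFunc L') Φ := (ψ.symm : RatFunc L' →+* Φ).toAlgebra

/-- **`e_ψ : Λ_Φ ≃+* Λ_{L'}`** — `Λ_Φ := AlgebraicClosure Φ` identified with GB-02's `ratClosure L'`, EXTENDING `ψ`
(`IsAlgClosure.equivOfEquiv`; ONE representative). ([IUTchI] Def 5.2 (v) p.135) [claim: Mochizuki2012, status: disputed] -/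
def transportClosureEquiv : AlgebraicClosure Φ ≃+* ratClosure L' :=
  haveI : Module.IsTorsionFree Φ (AlgebraicClosure Φ) := DivisionSemiring.to_moduleIsTorsionFree
  haveI : Module.IsTorsionFree (RatFunc L') (ratClosure L') := DivisionSemiring.to_moduleIsTorsionFree
  IsAlgClosure.equivOfEquiv (AlgebraicClosure Φ) (ratClosure L') ψ

/-- `e_ψ` EXTENDS `ψ` on `Φ ⊂ Λ_Φ`. ([IUTchI] Def 5.2 (v) p.135) [claim: Mochizuki2012, status: disputed] -/
theorem transportClosureEquiv_algebraMap (s : Φ) :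
    transportClosureEquiv ψ (algebraMap Φ (AlgebraicClosure Φ) s) = algebraMap (RatFunc L') (ratClosure L') (ψ s) := by
  haveI : Module.IsTorsionFree Φ (AlgebraicClosure Φ) := DivisionSemiring.to_moduleIsTorsionFree
  haveI : Module.IsTorsionFree (RatFunc L') (ratClosure L') := DivisionSemiring.to_moduleIsTorsionFree
  exact IsAlgClosure.equivOfEquiv_algebraMap (AlgebraicClosure Φ) (ratClosure L') ψ s

/-- `e_ψ` is `L'(t)`-LINEAR for the structure through `ψ⁻¹`. ([IUTchI] Def 5.2 (v) p.135) [claim: Mochizuki2012, status: disputed] -/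
theorem transportClosureEquiv_algebraMap_base (g : RatFunc L') :
    letI := transportAlgebra ψ
    transportClosureEquiv ψ (algebraMap (RatFunc L') (AlgebraicClosure Φ) g) = algebraMap (RatFunc L') (ratClosure L') g := by
  letI := transportAlgebra ψ
  rw [IsScalarTower.algebraMap_apply (RatFunc L') Φ (AlgebraicClosure Φ), transportClosureEquiv_algebraMap,
    RingHom.algebraMap_toAlgebra, RingHom.coe_coe, RingEquiv.apply_symm_apply]

/-- `e_ψ` as an isomorphism of `L'(t)`-ALGEBRAS. ([IUTchI] Def 5.2 (v) p.135) [claim: Mochizuki2012, status: disputed] -/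
def transportClosureAlgEquiv : letI := transportAlgebra ψ; AlgebraicClosure Φ ≃ₐ[RatFunc L'] ratClosure L' :=
  letI := transportAlgebra ψ
  AlgEquiv.ofRingEquiv (f := transportClosureEquiv ψ) (transportClosureEquiv_algebraMap_base ψ)

/-- `Λ_Φ` is INTEGRAL over `L'(t)` through `ψ⁻¹` (along `e_ψ`). ([IUTchI] Def 5.2 (v) p.135) [claim: Mochizuki2012, status: disputed] -/
theorem isIntegral_transport : letI := transportAlgebra ψ; Algebra.IsIntegral (RatFunc L') (AlgebraicClosure Φ) := by
  letI := transportAlgebra ψ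
  haveI := (transportClosureAlgEquiv ψ).symm.isAlgebraic
  exact Algebra.IsAlgebraic.isIntegral

/-- **`G_ψ^{rat} := Gal(Λ_Φ / L'(t))`** through `ψ⁻¹` — the TRANSPORTED presentation of `π₁^{rat}(‡𝒟_v)` (instances through the
`abbrev`, none declared). ([IUTchI] Def 5.2 (v) p.135) [claim: Mochizuki2012, status: disputed] -/
abbrev transportGal : Type u := letI := transportAlgebra ψ; AlgebraicClosure Φ ≃ₐ[RatFunc L'] AlgebraicClosure Φ

/-- **`ρ_ψ : G_ψ^{rat} ≃ₜ* G_{L'}^{rat}`** — conjugation by `e_ψ` (GB-07's `autCongrContinuous`), bicontinuous for the Krull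
topologies. ([IUTchI] Def 5.2 (v) p.135) [claim: Mochizuki2012, status: disputed] -/
def transportGalEquiv : transportGal ψ ≃ₜ* ratGalois L' :=
  letI := transportAlgebra ψ
  InitialThetaData.autCongrContinuous (transportClosureAlgEquiv ψ)

/-- **EQUIVARIANCE BY CONSTRUCTION**: `e_ψ (σ • x) = ρ_ψ(σ) • e_ψ x`. ([IUTchI] Def 5.2 (v) p.135) [claim: Mochizuki2012, status: disputed] -/
theorem transportClosureEquiv_smul (σ : transportGal ψ) (x : AlgebraicClosure Φ) :
    transportClosureEquiv ψ (σ • x) = transportGalEquiv ψ σ • transportClosureEquiv ψ x := by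
  change transportClosureEquiv ψ (σ x) =
    transportClosureEquiv ψ (σ ((transportClosureEquiv ψ).symm (transportClosureEquiv ψ x)))
  rw [RingEquiv.symm_apply_apply]

variable [CharZero L'] (S : CriticalLocus L') (U : Set L')

/-- **The TRANSPORTED t4-shape kit `G_ψ^{rat} ↷ 𝕄_{∞κ×v}(Λ_Φ) ⊇ 𝕄_{∞κv}(Λ_Φ)`**: GB-01's `CoricPair.ofStableSet` BY NAME at the
`e_ψ`-preimage of GB-02's `S.minfkxSet U` (stable by `smul_mem_minfkxSet` through `e_ψ`), with `∞κ`-part the elements whose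
`e_ψ`-image lies in `S.minfkSet` — GB-02's `infKappaCoricKit S U` carried along `e_ψ` (TRANSPORTED, NOT RECONSTRUCTED).
([IUTchI] Def 5.2 (v) p.135) [claim: Mochizuki2012, status: disputed] -/
abbrev transportKit : InfKappaCoricKit (transportGal ψ) :=
  letI := transportAlgebra ψ
  haveI := isIntegral_transport ψ
  { infkx := CoricPair.ofStableSet (RatFunc L') (AlgebraicClosure Φ) (transportClosureEquiv ψ ⁻¹' S.minfkxSet U)
      (fun σ _ hx => by
        show transportClosureEquiv ψ (σ • _) ∈ S.minfkxSet U
        rw [transportClosureEquiv_smul]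
        exact S.smul_mem_minfkxSet U _ hx)
    infk := ⟨{f | transportClosureEquiv ψ (f : AlgebraicClosure Φ) ∈ S.minfkSet}, fun σ f hf => by
      show transportClosureEquiv ψ (σ • (f : AlgebraicClosure Φ)) ∈ S.minfkSet
      rw [transportClosureEquiv_smul]
      exact S.smul_mem_minfkSet _ hf⟩ }

/-- **The TRANSPORTED local layer, bundled** (the `loc*` shape of `S5Local.InfKappaLink`). ([IUTchI] Def 5.2 (v) p.135)
[claim: Mochizuki2012, status: disputed] -/
abbrev transportLayer : LocalInfKappaLayer.{u} where
  rat := transportGal ψ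
  kit := transportKit ψ S U

/-- **Carrier identification `𝕄_{∞κ×v}(Λ_{L'}) ≃ 𝕄_{∞κ×v}(Λ_Φ)`** by `e_ψ⁻¹` (model ↦ transported). ([IUTchI] Def 5.2 (v) p.135)
[claim: Mochizuki2012, status: disputed] -/
def transportCarrierEquiv : (S.infKappaCoricKit U).infkx.carrier ≃ (transportKit ψ S U).infkx.carrier where
  toFun y := ⟨(transportClosureEquiv ψ).symm y, show transportClosureEquiv ψ _ ∈ S.minfkxSet U by
    rw [RingEquiv.apply_symm_apply]; exact y.2⟩
  invFun x := ⟨transportClosureEquiv ψ x, x.2⟩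
  left_inv y := Subtype.ext ((transportClosureEquiv ψ).apply_symm_apply y)
  right_inv x := Subtype.ext ((transportClosureEquiv ψ).symm_apply_apply x)

/-- `transportCarrierEquiv` is `e_ψ⁻¹` on elements. ([IUTchI] Def 5.2 (v) p.135) [claim: Mochizuki2012, status: disputed] -/
@[simp] theorem coe_transportCarrierEquiv (y : (S.infKappaCoricKit U).infkx.carrier) :
    ((transportCarrierEquiv ψ S U y : (transportKit ψ S U).infkx.carrier) : AlgebraicClosure Φ) =
      (transportClosureEquiv ψ).symm y := rfl

/-- `e_ψ⁻¹` identifies the `∞κ`-parts. ([IUTchI] Def 5.2 (v) p.135) [claim: Mochizuki2012, status: disputed] -/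
theorem transportCarrierEquiv_mem_infk_iff (y : (S.infKappaCoricKit U).infkx.carrier) :
    transportCarrierEquiv ψ S U y ∈ (transportKit ψ S U).infk ↔ y ∈ (S.infKappaCoricKit U).infk := by
  show transportClosureEquiv ψ ((transportClosureEquiv ψ).symm y) ∈ S.minfkSet ↔ _
  rw [RingEquiv.apply_symm_apply]
  rfl

/-- **Equivariance along `ρ_ψ`**: `e_ψ⁻¹ (ρ_ψ(γ) • y) = γ • e_ψ⁻¹ y` («Galois-compatible BY TRANSPORT»). ([IUTchI] Def 5.2 (v) p.135)
[claim: Mochizuki2012, status: disputed] -/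
theorem transportCarrierEquiv_smul (γ : transportGal ψ) (y : (S.infKappaCoricKit U).infkx.carrier) :
    transportCarrierEquiv ψ S U (transportGalEquiv ψ γ • y) = γ • transportCarrierEquiv ψ S U y := by
  apply Subtype.ext
  apply (transportClosureEquiv ψ).injective
  change transportClosureEquiv ψ ((transportClosureEquiv ψ).symm (transportGalEquiv ψ γ • (y : ratClosure L'))) =
    transportClosureEquiv ψ (γ • (transportClosureEquiv ψ).symm (y : ratClosure L'))
  rw [RingEquiv.apply_symm_apply, transportClosureEquiv_smul, RingEquiv.apply_symm_apply]

/-- The domains of the two partial multiplications correspond under `e_ψ⁻¹`. ([IUTchI] Def 5.2 (v) p.135)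
[claim: Mochizuki2012, status: disputed] -/
theorem mem_dom_iff_transportCarrierEquiv (q : (S.infKappaCoricKit U).infkx.carrier × (S.infKappaCoricKit U).infkx.carrier) :
    q ∈ (S.infKappaCoricKit U).infkx.pm.dom ↔
      (transportCarrierEquiv ψ S U q.1, transportCarrierEquiv ψ S U q.2) ∈ (transportKit ψ S U).infkx.pm.dom := by
  change (q.1 : ratClosure L') * q.2 ∈ S.minfkxSet U ↔
    transportClosureEquiv ψ ((transportClosureEquiv ψ).symm (q.1 : ratClosure L') *
      (transportClosureEquiv ψ).symm (q.2 : ratClosure L')) ∈ S.minfkxSet U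
  rw [map_mul, RingEquiv.apply_symm_apply, RingEquiv.apply_symm_apply]

/-- `e_ψ⁻¹` respects the partial multiplications. ([IUTchI] Def 5.2 (v) p.135) [claim: Mochizuki2012, status: disputed] -/
theorem transportCarrierEquiv_op (q : (S.infKappaCoricKit U).infkx.pm.dom) :
    transportCarrierEquiv ψ S U ((S.infKappaCoricKit U).infkx.pm.op q) =
      (transportKit ψ S U).infkx.pm.op ⟨(transportCarrierEquiv ψ S U q.1.1, transportCarrierEquiv ψ S U q.1.2),
        (mem_dom_iff_transportCarrierEquiv ψ S U q.1).mp q.2⟩ :=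
  Subtype.ext (map_mul (transportClosureEquiv ψ).symm (q.1.1 : ratClosure L') q.1.2)

/-- `1 ∈ 𝕄_{∞κv}(Λ_Φ)`: the transported `∞κ`-part is NONEMPTY (GB-12's `one_mem_minfkSet` through `e_ψ`). ([IUTchI] Rmk 3.1.7 (ii) p.67)
[claim: Mochizuki2012, status: disputed] -/
theorem exists_mem_transportKit_infk (hU : (1 : L') ∈ U) :
    ∃ f : (transportKit ψ S U).infkx.carrier, f ∈ (transportKit ψ S U).infk ∧ transportClosureEquiv ψ (f : AlgebraicClosure Φ) = 1 := by
  obtain ⟨g, hg, hg1⟩ := S.exists_infk_of_mem_minfkSet hU S.one_mem_minfkSet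
  exact ⟨transportCarrierEquiv ψ S U g, (transportCarrierEquiv_mem_infk_iff ψ S U g).mpr hg,
    by rw [coe_transportCarrierEquiv, RingEquiv.apply_symm_apply]; exact hg1⟩

/-! ### The two operations of Ex 5.4 (iv) for the transported layer over a base map `φ : L → L'` (GB-03's `ratHom`, GB-10 §1 + `e_ψ`) -/

variable {L : Type w} [Field L] [CharZero L] (φ : L →+* L') {S₀ : CriticalLocus L}
  (hS : S.pts = S₀.pts.map ⟨φ, φ.injective⟩) (hU : (1 : L') ∈ U)

/-- **`ratHom` OUT OF the transported group**: GB-03's `ratHom_φ : G_{L'}^{rat} →ₜ* G_L^{rat}` AFTER the conjugation `ρ_ψ`.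
([IUTchI] Ex 5.4 (iv) p.149) [claim: Mochizuki2012, status: disputed] -/
def transportRatHom : ContinuousMonoidHom (transportGal ψ) (ratGalois L) :=
  (RatBaseChange.ratHom φ).comp (transportGalEquiv ψ : transportGal ψ →ₜ* ratGalois L')

/-- **`resKummer` INTO the transported layer**: GB-10's generic `resKummerOfField φ` (`ι_φ` on carriers, landing in GB-02's layer at
`L'` for the transported locus `S`, `S.pts = φ (S₀.pts)`) FOLLOWED BY `e_ψ⁻¹`. ([IUTchI] Ex 5.4 (iv) p.149) [claim: Mochizuki2012, status: disputed] -/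
def transportResKummer : S₀.minfkCoricPair.carrier → (transportKit ψ S U).infkx.carrier :=
  fun m => transportCarrierEquiv ψ S U (resKummerOfField φ hS hU m)

/-- On elements `transportResKummer` is `e_ψ⁻¹ ∘ ι_φ`. ([IUTchI] Ex 5.4 (iv) p.149) [claim: Mochizuki2012, status: disputed] -/
theorem coe_transportResKummer (m : S₀.minfkCoricPair.carrier) :
    ((transportResKummer ψ S U φ hS hU m : (transportKit ψ S U).infkx.carrier) : AlgebraicClosure Φ) =
      (transportClosureEquiv ψ).symm (iota φ (m : ratClosure L)) := rfl

/-- **Clause (a), transported** («lands in `‡𝕄_{∞κv}`»): GB-10's `resKummerOfField_mem_infk` pulled back along `e_ψ⁻¹`.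
([IUTchI] Ex 5.4 (iv) p.149) [claim: Mochizuki2012, status: disputed] -/
theorem transportResKummer_mem_infk (m : S₀.minfkCoricPair.carrier) :
    transportResKummer ψ S U φ hS hU m ∈ (transportKit ψ S U).infk :=
  (transportCarrierEquiv_mem_infk_iff ψ S U _).mpr (resKummerOfField_mem_infk φ hS hU m)

/-- **Clause (b), transported** (equivariance along `transportRatHom = ratHom_φ ∘ ρ_ψ`): GB-10's `resKummerOfField_smul`, then
`transportCarrierEquiv_smul`. ([IUTchI] Ex 5.4 (iv) p.149) [claim: Mochizuki2012, status: disputed] -/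
theorem transportResKummer_smul (γ : transportGal ψ) (m : S₀.minfkCoricPair.carrier) :
    transportResKummer ψ S U φ hS hU (transportRatHom ψ φ γ • m) = γ • transportResKummer ψ S U φ hS hU m := by
  show transportCarrierEquiv ψ S U (resKummerOfField φ hS hU (RatBaseChange.ratHom φ (transportGalEquiv ψ γ) • m)) = _
  rw [resKummerOfField_smul, transportCarrierEquiv_smul]
  rfl

/-- **Clause (c), transported** (a morphism of pseudo-monoids, [IUTchI] §0 p. 33): `e_ψ⁻¹ ∘ ι_φ` is multiplicative on the domain.
([IUTchI] Ex 5.4 (iv) p.149) [claim: Mochizuki2012, status: disputed] -/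
theorem transportResKummer_op (p : S₀.minfkCoricPair.pm.dom) :
    ∃ h : (transportResKummer ψ S U φ hS hU p.1.1, transportResKummer ψ S U φ hS hU p.1.2) ∈ (transportKit ψ S U).infkx.pm.dom,
      transportResKummer ψ S U φ hS hU (S₀.minfkCoricPair.pm.op p) =
        (transportKit ψ S U).infkx.pm.op
          ⟨(transportResKummer ψ S U φ hS hU p.1.1, transportResKummer ψ S U φ hS hU p.1.2), h⟩ := by
  obtain ⟨h, -⟩ := resKummerOfField_op φ hS hU p
  have h' := (mem_dom_iff_transportCarrierEquiv ψ S U (resKummerOfField φ hS hU p.1.1, resKummerOfField φ hS hU p.1.2)).mp h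
  refine ⟨h', Subtype.ext ?_⟩
  show (transportClosureEquiv ψ).symm (iota φ ((p.1.1 : ratClosure L) * p.1.2)) =
    (transportClosureEquiv ψ).symm (iota φ p.1.1) * (transportClosureEquiv ψ).symm (iota φ p.1.2)
  rw [map_mul, map_mul]

end IsoTransport

end CriticalLocus

end Literature.IUT.HodgeTheaters

end
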